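import Summits.QuantumAdvantage.AdviceFreeQNC0.NPGamma37WalkLocalD
import HarnessLib

/-!
# Cell qa-qnc0 — (NP-W) part 2: the slice identity `faW_spec` and the theorems `ringHardWalkLocal3`, `ringHardWalkLocalLinForms3`

Planner qa-qnc0-p2 gen 34 (INBOX P2-34j, memo HOME/qa-qnc0-p2/ROUND-34P2.md §4.10).  The near-window selector `jsel`
(unique under `(2w+3)`-separation), the extra singleton polynomial `extraQ`/`QW` (in the span of `𝓢 ∪ Sing`), the move
vector `vloc` reconstructed from its value, the `a`-dependent table `faW`, THE SLICE IDENTITY `faW_spec` (window-locality of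
the table + locality of `tGuess`), and the theorems: `ringHardWalkLocal3 : RingHardWalkLocal3` (e = 7, C = 8, n₀ = 200) and
`ringHardWalkLocalLinForms3 : RingHardWalkLocalLinForms3` (e = 7, n₀ = 199) = p1's (J2⁻) `PerOutputGatesHardPoly` at the
ring charge `n + 2`, with `R < log₂(n+1)` dense forms per output and every window radius `w ≤ (n − 4)/(16 log₂(n+1)) − 3/2`.
-/
noncomputable section

namespace Summit.QuantumAdvantage.AdviceFreeQNC0.NPGamma37Proof

open Finset F4
open Classical
open Summit.QuantumAdvantage.AdviceFreeQNC0.AffBells37 (exists_ne_one_of_mass_lt ev L sparse_ne_one two_pow_L_le)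
open Summit.QuantumAdvantage.AdviceFreeQNC0.Resonance37G (xN xN_eq_xOfU)

variable {F : ℕ}

section WalkLocal

open Literature.Computability.QuantumComplexity Literature.Computability.QuantumComplexity.RingHLF
open Literature.Computability.MetaComplexity
open AffBells23 AffBells26
open Summit.QuantumAdvantage.AdviceFreeQNC0.NPGamma37 (NCoupled InsulatedWindows)

variable {n : ℕ}
variable {N : ℕ}
variable {R : ℕ}

/-! ### A congruence for `ringWinU` and unions of support families -/

/-- `ringWinU c y u` depends only on the output word `g ↦ y g u` (file-local copy; the tree has
`LinForms.ringWinU_congr` in `LinFormsRegular`, not imported here to keep the import cone small). -/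
private theorem ringWinU_congr (c : ℕ) {y y' : Fin (n + 1) → (Fin n → Bool) → Bool} {u : Fin n → Bool}
    (h : ∀ g, y g u = y' g u) : ringWinU c y u = ringWinU c y' u := by
  unfold ringWinU
  have hf : (univ.filter fun g : Fin (n + 1) => y g u = true ∧ (c + g.val + walkExp u g.val) % 3 ≠ 0)
      = (univ.filter fun g : Fin (n + 1) => y' g u = true ∧ (c + g.val + walkExp u g.val) % 3 ≠ 0) :=
    filter_congr fun g _ => by rw [h g]
  rw [hf]

/-- `H1'` is closed under union of support families. -/
theorem H1'_union {p : ℕ → ℕ} {𝓢 𝓣 : Set (Finset (Fin N))} (h : H1' p F 𝓢) (h' : H1' p F 𝓣) :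
    H1' p F (𝓢 ∪ 𝓣) := by
  intro S hS
  rcases hS with hS | hS
  exacts [h S hS, h' S hS]

/-- `H2'` is closed under union of support families. -/
theorem H2'_union {p q : ℕ → ℕ} {𝓢 𝓣 : Set (Finset (Fin N))} (h : H2' p q F 𝓢) (h' : H2' p q F 𝓣) :
    H2' p q F (𝓢 ∪ 𝓣) := by
  intro S hS
  rcases hS with hS | hS
  exacts [h S hS, h' S hS]

/-! ### Walk windows on a slice: the near window, the extra singleton polynomial, the `a`-dependent table -/

/-- window `j` is NEAR output `g`: `|p j − g| ≤ w + 1`. -/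
def Near (p : ℕ → ℕ) (w : ℕ) (g : Fin (n + 1)) (j : Fin F) : Prop := p j ≤ g.val + w + 1 ∧ g.val ≤ p j + w + 1

/-- under `(2w+3)`-separation at most one window is near each output. -/
theorem near_unique {p : ℕ → ℕ} {w : ℕ} (hsep : ∀ j j' : ℕ, j < j' → j' < F → p j + (2 * w + 3) ≤ p j')
    {g : Fin (n + 1)} {j j' : Fin F} (hj : Near p w g j) (hj' : Near p w g j') : j = j' := by
  by_contra h
  unfold Near at hj hj'
  rcases lt_or_gt_of_ne (fun hh : j.val = j'.val => h (Fin.ext hh)) with hlt | hgt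
  · have := hsep j.val j'.val hlt j'.isLt; omega
  · have := hsep j'.val j.val hgt j.isLt; omega

/-- the near-window selector. -/
def jsel (F : ℕ) (p : ℕ → ℕ) (w : ℕ) (g : Fin (n + 1)) : Option (Fin F) :=
  if h : ∃ j : Fin F, Near p w g j then some (Classical.choose h) else none

/-- Under `(2w+3)`-separation the selected window `jsel` is the unique window near `g`. -/
theorem jsel_spec {p : ℕ → ℕ} {w : ℕ} (hsep : ∀ j j' : ℕ, j < j' → j' < F → p j + (2 * w + 3) ≤ p j')
    {g : Fin (n + 1)} {j : Fin F} (hj : Near p w g j) : jsel F p w g = some j := by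
  have hex : ∃ j : Fin F, Near p w g j := ⟨j, hj⟩
  unfold jsel
  rw [dif_pos hex]
  exact congrArg some (near_unique hsep (Classical.choose_spec hex) hj)

/-- letter `m` of `x : Fin (n+1) → Bool`, ℕ-indexed (junk `false` out of range). -/
def xAt (x : Fin (n + 1) → Bool) (m : ℕ) : Bool := if h : m < n + 1 then x ⟨m, h⟩ else false

/-- `xAt (xOfU u) m` is the ℕ-indexed walk bit `xN u m`. -/
theorem xAt_xOfU (u : Fin n → Bool) {m : ℕ} (h : m < n + 1) : xAt (xOfU u) m = xN u m := by
  unfold xAt; rw [dif_pos h]; exact (xN_eq_xOfU u ⟨m, h⟩).symm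

/-- the singleton letter polynomial `x ↦ [x_m] ∈ {0,1} ⊂ 𝔽₃`. -/
def singQ (m : ℕ) : Smolensky.CubeFn (ZMod 3) (n + 1) := fun x => if xAt x m then 1 else 0

/-- The singleton polynomial `singQ m` is the monomial of `{m}`. -/
theorem singQ_eq_mono {m : ℕ} (h : m < n + 1) :
    (singQ m : Smolensky.CubeFn (ZMod 3) (n + 1)) = Smolensky.mono (ZMod 3) ({⟨m, h⟩} : Finset (Fin (n + 1))) := by
  funext x
  rw [mono_singleton]
  unfold singQ xAt
  rw [dif_pos h]

/-- the letter of a window start on a slice point: `x(U a v)_{p j} = x(a)_{p j} ⊕ v_j`. -/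
theorem xN_U_p {p : ℕ → ℕ} (hS : Sep n F p) (a : Fin n → Bool) (v : Fin F → Bool) (j : Fin F) :
    xN (U p a v) (p j) = xor (xN a (p j)) (v j) := by
  have h1 := hS.1 j
  have hne : ∀ j' : Fin F, p j' ≠ p j - 1 := by
    intro j' hj'
    rcases eq_or_ne j' j with rfl | hjj
    · omega
    · rcases hS.ne hjj with h | h <;> omega
  unfold xN
  rw [if_neg (show p j ≠ 0 by omega), if_neg (show p j ≠ 0 by omega), uExt_U hS, uExt_U hS, wE_self hS,
    wE_false_of_ne v hne]
  cases uExt a (p j) <;> cases uExt a (p j - 1) <;> cases v j <;> rfl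

/-- the extra polynomial of output `g`: the letter of its near window, `0` if there is none. -/
def extraQ (p : ℕ → ℕ) (jn : Fin (n + 1) → Option (Fin F)) (g : Fin (n + 1)) : Smolensky.CubeFn (ZMod 3) (n + 1) :=
  (jn g).elim 0 fun j => singQ (p j)

/-- the extended polynomial vector `(Q g, extraQ g)` of output `g`. -/
def QW (Q : Fin (n + 1) → Fin R → Smolensky.CubeFn (ZMod 3) (n + 1)) (p : ℕ → ℕ) (jn : Fin (n + 1) → Option (Fin F)) :
    Fin (n + 1) → Fin (R + 1) → Smolensky.CubeFn (ZMod 3) (n + 1) :=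
  fun g => Fin.snoc (Q g) (extraQ p jn g)

/-- The first `R` values of the extended family `QW` are the values of `Q`. -/
theorem qvals_QW_castSucc (Q : Fin (n + 1) → Fin R → Smolensky.CubeFn (ZMod 3) (n + 1)) (p : ℕ → ℕ)
    (jn : Fin (n + 1) → Option (Fin F)) (g : Fin (n + 1)) (x : Fin (n + 1) → Bool) :
    (fun i => qvals (QW Q p jn) g x (Fin.castSucc i)) = fun i => Q g i x := by
  funext i
  unfold qvals QW
  rw [Fin.snoc_castSucc]

/-- The last value of the extended family `QW` is the extra window polynomial `extraQ`. -/
theorem qvals_QW_last (Q : Fin (n + 1) → Fin R → Smolensky.CubeFn (ZMod 3) (n + 1)) (p : ℕ → ℕ)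
    (jn : Fin (n + 1) → Option (Fin F)) (g : Fin (n + 1)) (x : Fin (n + 1) → Bool) :
    qvals (QW Q p jn) g x (Fin.last R) = extraQ p jn g x := by
  unfold qvals QW
  rw [Fin.snoc_last]

/-- the extended polynomials lie in the span of `𝓢 ∪ Sing`. -/
theorem QW_mem_span {p : ℕ → ℕ} (hS : Sep n F p) {𝓢 : Set (Finset (Fin (n + 1)))}
    {Q : Fin (n + 1) → Fin R → Smolensky.CubeFn (ZMod 3) (n + 1)}
    (hQ : ∀ g i, Q g i ∈ Submodule.span (ZMod 3) (Smolensky.mono (ZMod 3) '' 𝓢)) (jn : Fin (n + 1) → Option (Fin F)) :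
    ∀ g i, QW Q p jn g i ∈ Submodule.span (ZMod 3) (Smolensky.mono (ZMod 3) '' (𝓢 ∪ Sing (n + 1))) := by
  intro g i
  unfold QW
  refine Fin.lastCases ?_ (fun i => ?_) i
  · rw [Fin.snoc_last]
    unfold extraQ
    cases jn g with
    | none => exact Submodule.zero_mem _
    | some j =>
      simp only [Option.elim]
      have h := hS.1 j
      rw [singQ_eq_mono (show p j < n + 1 by omega)]
      exact Submodule.subset_span ⟨{⟨p j, by omega⟩}, Or.inr ⟨⟨p j, by omega⟩, rfl⟩, rfl⟩
  · rw [Fin.snoc_castSucc]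
    exact Submodule.span_mono (Set.image_mono Set.subset_union_left) (hQ g i)

/-- the move vector reconstructed on the slice of `a` from the value `s` of the extra polynomial. -/
def vloc (p : ℕ → ℕ) (jn : Fin (n + 1) → Option (Fin F)) (a : Fin n → Bool) (g : Fin (n + 1)) (s : ZMod 3) :
    Fin F → Bool :=
  fun j' => decide (jn g = some j') && xor (decide (s = 1)) (xN a (p j'))

/-- the `a`-DEPENDENT table of output `g`: the original table at the reconstructed walk, corrected by `tGuess`. -/
def faW (p : ℕ → ℕ) (jn : Fin (n + 1) → Option (Fin F)) (Fg : Fin (n + 1) → (Fin R → ZMod 3) → (Fin n → Bool) → Bool)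
    (a : Fin n → Bool) (g : Fin (n + 1)) (t' : Fin (R + 1) → ZMod 3) : Bool :=
  xor (Fg g (fun i => t' (Fin.castSucc i)) (U p a (vloc p jn a g (t' (Fin.last R)))))
    (tGuess (xOfU (U p a (vloc p jn a g (t' (Fin.last R))))) g)

/-- on the slice of `a`, the reconstructed move vector agrees with `v` on every window near `g`. -/
theorem vloc_near {p : ℕ → ℕ} {w : ℕ} (hS : Sep n F p) {jn : Fin (n + 1) → Option (Fin F)}
    (hjn : ∀ (g : Fin (n + 1)) (j : Fin F), Near p w g j → jn g = some j)
    (a : Fin n → Bool) (v : Fin F → Bool) (g : Fin (n + 1)) :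
    ∀ j' : Fin F, Near p w g j' → vloc p jn a g (extraQ p jn g (xOfU (U p a v))) j' = v j' := by
  intro j' hj'
  have hg := hjn g j' hj'
  have h1 := hS.1 j'
  have hs : extraQ p jn g (xOfU (U p a v)) = if xN (U p a v) (p j') then 1 else 0 := by
    unfold extraQ
    rw [hg]
    simp only [Option.elim]
    unfold singQ
    rw [xAt_xOfU _ (show p j' < n + 1 by omega)]
  unfold vloc
  rw [hs, xN_U_p hS, hg]
  simp only [decide_true, Bool.true_and]
  cases xN a (p j') <;> cases v j' <;> decide

/-- window indicator bits agree where all candidate windows are near. -/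
theorem wE_agree {p : ℕ → ℕ} {w : ℕ} {g : Fin (n + 1)} {V v : Fin F → Bool}
    (hVv : ∀ j' : Fin F, Near p w g j' → V j' = v j') (m : ℕ) (hm : ∀ j' : Fin F, p j' = m → Near p w g j') :
    wE p V m = wE p v m := by
  rw [Bool.eq_iff_iff, wE_true_iff, wE_true_iff]
  constructor
  · rintro ⟨j', h1, h2⟩
    exact ⟨j', h1, by rw [← hVv j' (hm j' h1)]; exact h2⟩
  · rintro ⟨j', h1, h2⟩
    exact ⟨j', h1, by rw [hVv j' (hm j' h1)]; exact h2⟩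

/-- letters agree where all candidate windows are near. -/
theorem xOfU_agree {p : ℕ → ℕ} {w : ℕ} (hS : Sep n F p) {g : Fin (n + 1)} {V v : Fin F → Bool} (a : Fin n → Bool)
    (hVv : ∀ j' : Fin F, Near p w g j' → V j' = v j') (i : Fin (n + 1))
    (hi : ∀ j' : Fin F, (i.val = p j' ∨ i.val = p j' + 1) → Near p w g j') :
    xOfU (U p a V) i = xOfU (U p a v) i := by
  rw [xOfU_U_eq hS a V i, xOfU_U_eq hS a v i]
  have he : (∃ j' : Fin F, (i.val = p j' ∨ i.val = p j' + 1) ∧ V j' = true) ↔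
      (∃ j' : Fin F, (i.val = p j' ∨ i.val = p j' + 1) ∧ v j' = true) := by
    constructor
    · rintro ⟨j', h1, h2⟩
      exact ⟨j', h1, by rw [← hVv j' (hi j' h1)]; exact h2⟩
    · rintro ⟨j', h1, h2⟩
      exact ⟨j', h1, by rw [hVv j' (hi j' h1)]; exact h2⟩
  by_cases h1 : ∃ j' : Fin F, (i.val = p j' ∨ i.val = p j' + 1) ∧ V j' = true
  · rw [if_pos h1, if_pos (he.1 h1)]
  · rw [if_neg h1, if_neg (fun h2 => h1 (he.2 h2))]

/-- **THE SLICE IDENTITY**: on every slice, the `a`-dependent table of the extended polynomials reproduces the walk-local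
strategy (xored with `tGuess`, as the transport `yOf` requires). -/
theorem faW_spec {p : ℕ → ℕ} {w : ℕ} (hS : Sep n F p) {jn : Fin (n + 1) → Option (Fin F)}
    (hjn : ∀ (g : Fin (n + 1)) (j : Fin F), Near p w g j → jn g = some j)
    (Q : Fin (n + 1) → Fin R → Smolensky.CubeFn (ZMod 3) (n + 1))
    {Fg : Fin (n + 1) → (Fin R → ZMod 3) → (Fin n → Bool) → Bool} (hloc : ∀ t, WindowLocal w (fun g u => Fg g t u))
    (a : Fin n → Bool) (v : Fin F → Bool) (g : Fin (n + 1)) :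
    faW p jn Fg a g (qvals (QW Q p jn) g (xOfU (U p a v)))
      = xor (Fg g (fun i => Q g i (xOfU (U p a v))) (U p a v)) (tGuess (xOfU (U p a v)) g) := by
  unfold faW
  rw [qvals_QW_castSucc, qvals_QW_last]
  set V := vloc p jn a g (extraQ p jn g (xOfU (U p a v))) with hV
  have hVv : ∀ j' : Fin F, Near p w g j' → V j' = v j' := vloc_near hS hjn a v g
  -- the walk window of `g`
  have hF : Fg g (fun i => Q g i (xOfU (U p a v))) (U p a V) = Fg g (fun i => Q g i (xOfU (U p a v))) (U p a v) := by
    refine hloc _ g (U p a V) (U p a v) fun i hi1 hi2 => ?_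
    show xor (a i) (wE p V i.val) = xor (a i) (wE p v i.val)
    rw [wE_agree hVv i.val fun j' hj' => ?_]
    unfold Near; omega
  -- the two letters read by `tGuess`
  have hp1 : ∀ j' : Fin F, 1 ≤ p j' := fun j' => (hS.1 j').1
  have hng : (nxt g).val = (g.val + 1) % (n + 1) := rfl
  have h01 : (nxt g).val = g.val + 1 ∨ (nxt g).val = 0 := by
    rcases Nat.lt_or_ge (g.val + 1) (n + 1) with h | h
    · left; rw [hng, Nat.mod_eq_of_lt h]
    · right; rw [hng, show g.val + 1 = n + 1 by omega, Nat.mod_self]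
  have hT : tGuess (xOfU (U p a V)) g = tGuess (xOfU (U p a v)) g := by
    unfold tGuess
    rw [xOfU_agree hS a hVv g fun j' hj' => ?_, xOfU_agree hS a hVv (nxt g) fun j' hj' => ?_]
    all_goals
      have := hp1 j'
      unfold Near; omega
  rw [hF, hT]

/-! ### (NP-W) THE THEOREMS -/

/-- **THE CORE**: an interleaved, `(2w+3)`-separated system of `8 log₂(n+1)` windows that is (H1′)/(H2′) for `𝓢`, `R < log₂(n+1)`
span-polynomials per output and ANY `w`-walk-window post-processing ⇒ at most `(1 − (n+1)^{-7})·2ⁿ` winning walks at the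
ring charge. -/
theorem walkLocal_core {p q : ℕ → ℕ} {w : ℕ} (hN : 200 ≤ n + 1)
    (hord : ∀ j < 8 * Nat.log 2 (n + 1), q j < p j ∧ p j + 1 < q (j + 1)) (hqF : q (8 * Nat.log 2 (n + 1)) < n)
    (hsep : ∀ j j' : ℕ, j < j' → j' < 8 * Nat.log 2 (n + 1) → p j + (2 * w + 3) ≤ p j')
    {𝓢 : Set (Finset (Fin (n + 1)))} (h1 : H1' p (8 * Nat.log 2 (n + 1)) 𝓢)
    (h2 : H2' p q (8 * Nat.log 2 (n + 1)) 𝓢) (hR : R < Nat.log 2 (n + 1))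
    (Q : Fin (n + 1) → Fin R → Smolensky.CubeFn (ZMod 3) (n + 1))
    (hQ : ∀ g i, Q g i ∈ Submodule.span (ZMod 3) (Smolensky.mono (ZMod 3) '' 𝓢))
    (Fg : Fin (n + 1) → (Fin R → ZMod 3) → (Fin n → Bool) → Bool) (hloc : ∀ t, WindowLocal w (fun g u => Fg g t u)) :
    ((univ.filter fun u : Fin n → Bool =>
        ringWinU (n + 2) (fun g u => Fg g (fun i => Q g i (xOfU u)) u) u = true).card : ℝ)
      ≤ (1 - 1 / ((n : ℝ) + 1) ^ 7) * (2 : ℝ) ^ n := by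
  have hS := sep_of_ord hord hqF
  -- the near-window selector and the extended family
  have hjn : ∀ (g : Fin (n + 1)) (j : Fin (8 * Nat.log 2 (n + 1))), Near p w g j →
      jsel (8 * Nat.log 2 (n + 1)) p w g = some j := fun g j hj => jsel_spec hsep hj
  have h1' := H1'_union h1 (H1'_sing hS)
  have h2' := H2'_union h2 (H2'_sing hord)
  have hQW := QW_mem_span hS hQ (jsel (8 * Nat.log 2 (n + 1)) p w)
  have hSAIA := SAIA_of_span hS h1' h2' (QW Q p (jsel (8 * Nat.log 2 (n + 1)) p w)) hQW
  obtain ⟨h34N, h2C, hK, -⟩ := numericsΛ (R := R + 1) hN (by omega)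
  -- the slice identity
  have hy : ∀ (a : Fin n → Bool) (v : Fin (8 * Nat.log 2 (n + 1)) → Bool),
      ringWinU (n + 2) (fun g u => Fg g (fun i => Q g i (xOfU u)) u) (U p a v)
        = Wn (PQ (QW Q p (jsel (8 * Nat.log 2 (n + 1)) p w)) (faW p (jsel (8 * Nat.log 2 (n + 1)) p w) Fg a))
            (U p a v) := by
    intro a v
    unfold Wn
    refine ringWinU_congr (n + 2) fun g => ?_
    unfold yOf
    rw [zOf_PQ]
    show Fg g (fun i => Q g i (xOfU (U p a v))) (U p a v)
      = xor (faW p (jsel (8 * Nat.log 2 (n + 1)) p w) Fg a g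
          (qvals (QW Q p (jsel (8 * Nat.log 2 (n + 1)) p w)) g (xOfU (U p a v)))) (tGuess (xOfU (U p a v)) g)
    rw [faW_spec hS hjn Q hloc a v g]
    generalize Fg g (fun i => Q g i (xOfU (U p a v))) (U p a v) = b
    generalize tGuess (xOfU (U p a v)) g = t
    cases b <;> cases t <;> rfl
  have hmain := fourierLossD hord hqF (QW Q p (jsel (8 * Nat.log 2 (n + 1)) p w))
    (faW p (jsel (8 * Nat.log 2 (n + 1)) p w) Fg) _ hy (fun k g => (hSAIA k g).1) (fun k g => (hSAIA k g).2)
    h34N h2C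
  rw [card_IxL] at hmain
  exact law_of_loss hmain hK

/-- **(NP-W), explicit constants**: `e = 7`, `C = 8`, `n₀ = 200`. -/
theorem ringHardWalkLocal3_explicit : ∀ n : ℕ, 200 ≤ n + 1 → ∀ w : ℕ, ∀ 𝓢 : Set (Finset (Fin (n + 1))),
    InsulatedWindowsSep 𝓢 (8 * Nat.log 2 (n + 1)) (2 * w + 3) →
    ∀ R < Nat.log 2 (n + 1), ∀ Q : Fin (n + 1) → Fin R → Smolensky.CubeFn (ZMod 3) (n + 1),
      (∀ g i, Q g i ∈ Submodule.span (ZMod 3) (Smolensky.mono (ZMod 3) '' 𝓢)) →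
      ∀ Fg : Fin (n + 1) → (Fin R → ZMod 3) → (Fin n → Bool) → Bool,
        (∀ t, WindowLocal w (fun g u => Fg g t u)) →
        ((univ.filter fun u : Fin n → Bool =>
            ringWinU (n + 2) (fun g u => Fg g (fun i => Q g i (xOfU u)) u) u = true).card : ℝ)
          ≤ (1 - 1 / ((n : ℝ) + 1) ^ 7) * (2 : ℝ) ^ n := by
  intro n hN w 𝓢 hW R hR Q hQ Fg hloc
  obtain ⟨p, q, _, hqF3, hord, h4, h5, hsep⟩ := hW
  obtain ⟨h1, h2⟩ := H1'_H2'_of_insulated h4 h5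
  have hqF : q (8 * Nat.log 2 (n + 1)) < n := by omega
  exact walkLocal_core hN hord hqF hsep h1 h2 hR Q hQ Fg hloc

/-- **(NP-W) PROVED**: `RingHardWalkLocal3` with `e = 7`, `C = 8`, `n₀ = 200`. -/
theorem ringHardWalkLocal3 : RingHardWalkLocal3 := ⟨7, 8, 200, ringHardWalkLocal3_explicit⟩

/-- **(NP-WΛ), explicit constants** (p1's (J2⁻) at the ring charge): `e = 7`, `n₀ = 199`; windows `p_j = (2w+3)j + 3`,
insulators `q_i = (2w+3)i + 2`, the singleton family. -/
theorem ringHardWalkLocalLinForms3_explicit : ∀ n ≥ 199, ∀ w : ℕ, 8 * Nat.log 2 (n + 1) * (2 * w + 3) + 4 ≤ n →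
    ∀ R < Nat.log 2 (n + 1), ∀ Lf : Fin (n + 1) → Fin R → Fin (n + 1) → ZMod 3,
      ∀ Fg : Fin (n + 1) → (Fin R → ZMod 3) → (Fin n → Bool) → Bool,
        (∀ t, WindowLocal w (fun g u => Fg g t u)) →
        ((univ.filter fun u : Fin n → Bool =>
            ringWinU (n + 2) (fun g u => Fg g (fun i => ∑ m : Fin (n + 1), if xOfU u m then Lf g i m else 0) u) u
              = true).card : ℝ)
          ≤ (1 - 1 / ((n : ℝ) + 1) ^ 7) * (2 : ℝ) ^ n := by
  intro n hn w hw R hR Lf Fg hloc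
  -- the window/insulator system `p_j = D j + 3`, `q_i = D i + 2`, `D = 2w + 3`
  have hord : ∀ j < 8 * Nat.log 2 (n + 1), (fun i => (2 * w + 3) * i + 2) j < (fun j => (2 * w + 3) * j + 3) j ∧
      (fun j => (2 * w + 3) * j + 3) j + 1 < (fun i => (2 * w + 3) * i + 2) (j + 1) := by
    intro j _
    simp only
    have : (2 * w + 3) * (j + 1) = (2 * w + 3) * j + (2 * w + 3) := by ring
    omega
  have hqF : (fun i => (2 * w + 3) * i + 2) (8 * Nat.log 2 (n + 1)) < n := by
    simp only
    have : (2 * w + 3) * (8 * Nat.log 2 (n + 1)) = 8 * Nat.log 2 (n + 1) * (2 * w + 3) := by ring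
    omega
  have hsep : ∀ j j' : ℕ, j < j' → j' < 8 * Nat.log 2 (n + 1) →
      (fun j => (2 * w + 3) * j + 3) j + (2 * w + 3) ≤ (fun j => (2 * w + 3) * j + 3) j' := by
    intro j j' hjj _
    simp only
    have h1 : (2 * w + 3) * (j + 1) ≤ (2 * w + 3) * j' := Nat.mul_le_mul_left _ (by omega)
    have h2 : (2 * w + 3) * (j + 1) = (2 * w + 3) * j + (2 * w + 3) := by ring
    omega
  have hS := sep_of_ord hord hqF
  have hQ : ∀ (g : Fin (n + 1)) (i : Fin R), (fun g i => LinF (Lf g i)) g i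
      ∈ Submodule.span (ZMod 3) (Smolensky.mono (ZMod 3) '' Sing (n + 1)) := fun g i => LinF_mem_span (Lf g i)
  exact walkLocal_core (by omega) hord hqF hsep (H1'_sing hS) (H2'_sing hord) hR (fun g i => LinF (Lf g i)) hQ Fg hloc

/-- **(NP-WΛ) PROVED**: `RingHardWalkLocalLinForms3` with `e = 7`, `n₀ = 199`. -/
theorem ringHardWalkLocalLinForms3 : RingHardWalkLocalLinForms3 := ⟨7, 199, ringHardWalkLocalLinForms3_explicit⟩

end WalkLocal

end Summit.QuantumAdvantage.AdviceFreeQNC0.NPGamma37Proof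

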